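import Literature.AlgebraicGeometry.HodgeTheory.UnitaryReflectionGroupZariskiDense
import HarnessLib

/-!
# No twist-isomorphism between factors carrying pseudo-reflections with different multipliers
# (discharging hypotheses (3)–(4) of the Goursat–Kolchin–Ribet criterion, Katz 1990 Prop. 1.8.2, for
# reflection groups; Carlson–Toledo 1999 §7)

Family `hodge`, layer `Literature/AlgebraicGeometry/HodgeTheory`. THEOREMS only. Companion of littype's
`GoursatKolchinRibetCriterion` (the named fact `Katz1990_goursatKolchinRibet_specialLinear`, whose
hypotheses (3)/(4) ask that NO linear isomorphism `A : Eᵢ ≅ Eⱼ` (resp. `A : Eᵢ^* ≅ Eⱼ`) and no function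
`χ` satisfy `A ∘ sᵢ = χ(s) • sⱼ ∘ A` for all `s` in the group) and of `UnitaryReflectionGroupZariskiDense`
(`complexReflection B ε λ δ`). For the monodromy group of the cyclic family (crux K1
`VeryGeneralDeckCommutatorsInHg` of `Summits/HodgeConjecture/HodgeConjecture/Theses/CyclicUnitaryPowers.lean`,
skeleton v7 lanes A/D, memo STUB-PLAN-B2-g19 §2 R4: "comparing eigenvalue multisets `{σ(ζ^j), 1, …, 1}` vs
`c·{σ'(ζ^j)^{±1}, 1, …, 1}` gives `σ = σ'`") the element `s = ρ(r_δ)` acts on every eigenspace `E_j` by a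
complex reflection with multiplier `ζ^j`; this file proves the linear algebra that turns such an `s` into
a refutation of (3)/(4): a twisted conjugacy `A R A⁻¹ = χ R'` between PSEUDO-REFLECTIONS (`rank(R − 1) =
rank(R' − 1) = 1`) in dimension `≥ 3` forces `χ = 1` (rank count: `rank(χR' − 1) ≥ n − 1` for `χ ≠ 1`)
and then `tr R = tr R'`, i.e. equal multipliers. Written by the prover seat `hodge-nonav-prover-Ax`.

## What is proved (any field `K`)
* `finrank_le_finrank_range_one_add` — `dim E ≤ rank(1 + N) + rank N`.
* **`twist_eq_one_of_rank_sub_one`** — `A ∘ R = χ • (R' ∘ A)`, `A : E ≃ E'`, `rank(R − 1) = 1`,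
  `rank(R' − 1) ≤ 1`, `dim E ≥ 3` ⟹ `χ = 1`; **`trace_eq_of_conj_eq`** — then `tr R = tr R'`.
* For Carlson–Toledo's `complexReflection B ε λ δ` (`h(δ,δ) = ε = ±1`): `trace_complexReflection`
  (`= dim W + (λ − 1)`), `finrank_range_complexReflection_sub_id` (`= 1` for `λ ≠ 1`), and the packaged
  refutation `multiplier_eq_of_twist_complexReflection`: a twisted conjugacy between `λ`- and `λ'`-reflections
  of spaces of dimension `≥ 3` forces `λ = λ'`.

## References
* [Katz1990ESDE] N. M. Katz, *Exponential Sums and Differential Equations* (1990), §1.8 Prop. 1.8.2,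
  hypotheses (3)–(4).
* [CarlsonToledo1999] J. A. Carlson, D. Toledo, Duke Math. J. 97 (1999), §6 Proposition (local monodromy =
  complex reflection with eigenvalue `(−1)^{n+1}ζ^i` on the `i`-th eigenspace), §7.
-/

noncomputable section

open Module

namespace Literature.AlgebraicGeometry.HodgeTheory

/-! ### §1 Twisted conjugacy of pseudo-reflections (any field) -/

section Twist

variable {K : Type*} [Field K] {E E' : Type*} [AddCommGroup E] [Module K E] [FiniteDimensional K E]
  [AddCommGroup E'] [Module K E'] [FiniteDimensional K E']

/-- `dim E ≤ rank(1 + N) + rank N` (`x = (1 + N)x − Nx`). [cite: Katz1990ESDE, §1.8 Prop. 1.8.2] -/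
theorem finrank_le_finrank_range_one_add (N : E →ₗ[K] E) :
    finrank K E ≤ finrank K (LinearMap.range (1 + N)) + finrank K (LinearMap.range N) := by
  have htop : (⊤ : Submodule K E) ≤ LinearMap.range (1 + N) ⊔ LinearMap.range N := by
    intro x _
    have hx : x = (1 + N) x - N x := by simp
    rw [hx]
    exact Submodule.sub_mem _ (Submodule.mem_sup_left ⟨x, rfl⟩) (Submodule.mem_sup_right ⟨x, rfl⟩)
  calc finrank K E = finrank K (⊤ : Submodule K E) := (finrank_top K E).symm
    _ ≤ finrank K ↥(LinearMap.range (1 + N) ⊔ LinearMap.range N) := Submodule.finrank_mono htop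
    _ ≤ _ := Submodule.finrank_add_le_finrank_add_finrank _ _

omit [FiniteDimensional K E] [FiniteDimensional K E'] in
/-- A twisted intertwining `A ∘ R = χ • (R' ∘ A)` along an isomorphism is a twisted conjugacy
`A R A⁻¹ = χ R'`. [cite: Katz1990ESDE, §1.8 Prop. 1.8.2] -/
theorem conj_eq_smul_of_comp_eq (A : E ≃ₗ[K] E') {R : E →ₗ[K] E} {R' : E' →ₗ[K] E'} {χ : K}
    (hA : (A : E →ₗ[K] E') ∘ₗ R = χ • (R' ∘ₗ (A : E →ₗ[K] E'))) : A.conj R = χ • R' := by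
  rw [LinearEquiv.conj_apply, hA]
  ext x
  simp

omit [FiniteDimensional K E] [FiniteDimensional K E'] in
/-- Conjugation preserves the rank of `M`: `rank(A M A⁻¹) = rank M`. [cite: Katz1990ESDE, §1.8 Prop. 1.8.2] -/
theorem finrank_range_conj (A : E ≃ₗ[K] E') (M : E →ₗ[K] E) :
    finrank K (LinearMap.range (A.conj M)) = finrank K (LinearMap.range M) := by
  rw [LinearEquiv.conj_apply, LinearMap.range_comp_of_range_eq_top _ (LinearMap.range_eq_top.2 A.symm.surjective),
    LinearMap.range_comp]
  exact LinearEquiv.finrank_map_eq A (LinearMap.range M)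

omit [FiniteDimensional K E] in
/-- **A twisted conjugacy between pseudo-reflections has trivial twist**: if `A ∘ R = χ • (R' ∘ A)` for an
isomorphism `A : E ≅ E'` with `rank(R − 1) = 1`, `rank(R' − 1) ≤ 1` and `dim E ≥ 3`, then `χ = 1` —
otherwise `1 = rank(A(R−1)A⁻¹) = rank(χR' − 1) ≥ dim E − 1 ≥ 2`. (Katz's hypothesis (3): no
`ρᵢ ≅ χ ⊗ ρⱼ`; for reflection groups the eigenvalue-multiset comparison of STUB-PLAN-B2 R4.)
[cite: Katz1990ESDE, §1.8 Prop. 1.8.2] -/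
theorem twist_eq_one_of_rank_sub_one (h3 : 3 ≤ finrank K E) {R : E →ₗ[K] E} {R' : E' →ₗ[K] E'}
    (hR : finrank K (LinearMap.range (R - 1)) = 1) (hR' : finrank K (LinearMap.range (R' - 1)) ≤ 1)
    (A : E ≃ₗ[K] E') {χ : K} (hA : (A : E →ₗ[K] E') ∘ₗ R = χ • (R' ∘ₗ (A : E →ₗ[K] E'))) : χ = 1 := by
  by_contra hχ
  have hconj := conj_eq_smul_of_comp_eq A hA
  -- `rank(χ R' − 1) = rank(R − 1) = 1`
  have h1 : finrank K (LinearMap.range (χ • R' - 1)) = 1 := by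
    have hc1 : A.conj (1 : E →ₗ[K] E) = 1 := LinearEquiv.conj_id A
    rw [← hconj, ← hc1, ← map_sub, finrank_range_conj, hR]
  -- `χ R' − 1 = (χ − 1) • (1 + N)`, `N = (χ/(χ−1)) • (R' − 1)` of rank `≤ 1`
  have hχ1 : χ - 1 ≠ 0 := sub_ne_zero.2 hχ
  set N : E' →ₗ[K] E' := (χ / (χ - 1)) • (R' - 1) with hN
  have hdec : χ • R' - 1 = (χ - 1) • (1 + N) := by
    rw [hN, smul_add, smul_smul, mul_div_cancel₀ _ hχ1]
    ext x
    simp only [LinearMap.sub_apply, LinearMap.smul_apply, Module.End.one_apply, LinearMap.add_apply, sub_smul,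
      smul_sub, one_smul]
    abel
  have hrk : finrank K (LinearMap.range (1 + N)) = 1 := by
    rw [← h1, hdec, LinearMap.range_smul _ _ hχ1]
  have hN1 : finrank K (LinearMap.range N) ≤ 1 := by
    refine le_trans (Submodule.finrank_mono ?_) hR'
    rintro _ ⟨y, rfl⟩
    exact ⟨(χ / (χ - 1)) • y, by rw [hN, LinearMap.smul_apply, map_smul]⟩
  have hdim : finrank K E' ≤ 2 := by
    have := finrank_le_finrank_range_one_add N
    omega
  have hEE' : finrank K E = finrank K E' := A.finrank_eq
  omega

omit [FiniteDimensional K E] [FiniteDimensional K E'] in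
/-- **Untwisted conjugates have equal traces**: `A ∘ R = R' ∘ A` along an isomorphism gives `tr R = tr R'`.
[cite: Katz1990ESDE, §1.8 Prop. 1.8.2] -/
theorem trace_eq_of_conj_eq (A : E ≃ₗ[K] E') {R : E →ₗ[K] E} {R' : E' →ₗ[K] E'}
    (hA : (A : E →ₗ[K] E') ∘ₗ R = R' ∘ₗ (A : E →ₗ[K] E')) :
    LinearMap.trace K E R = LinearMap.trace K E' R' := by
  have h := conj_eq_smul_of_comp_eq A (χ := 1) (by rw [one_smul]; exact hA)
  rw [one_smul] at h
  rw [← h, LinearMap.trace_conj']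

omit [FiniteDimensional K E] in
/-- The two together: a twisted conjugacy of pseudo-reflections in dimension `≥ 3` is an honest conjugacy,
so the traces agree. [cite: Katz1990ESDE, §1.8 Prop. 1.8.2] -/
theorem trace_eq_of_twist_of_rank_sub_one (h3 : 3 ≤ finrank K E) {R : E →ₗ[K] E} {R' : E' →ₗ[K] E'}
    (hR : finrank K (LinearMap.range (R - 1)) = 1) (hR' : finrank K (LinearMap.range (R' - 1)) ≤ 1)
    (A : E ≃ₗ[K] E') {χ : K} (hA : (A : E →ₗ[K] E') ∘ₗ R = χ • (R' ∘ₗ (A : E →ₗ[K] E'))) :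
    χ = 1 ∧ LinearMap.trace K E R = LinearMap.trace K E' R' := by
  have hχ := twist_eq_one_of_rank_sub_one h3 hR hR' A hA
  subst hχ
  rw [one_smul] at hA
  exact ⟨rfl, trace_eq_of_conj_eq A hA⟩

omit [FiniteDimensional K E] in
/-- The transpose `(R⁻¹)ᵗ` on the dual (Katz's contragredient in (4)) is again a pseudo-reflection when
`R⁻¹` is: `rank((M)ᵗ) = rank M`. [cite: Katz1990ESDE, §1.8 Prop. 1.8.2] -/
theorem finrank_range_dualMap_sub_one (M : E →ₗ[K] E) :
    finrank K (LinearMap.range (M.dualMap - 1)) = finrank K (LinearMap.range (M - 1)) := by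
  have h : M.dualMap - 1 = (M - 1).dualMap := by
    change Module.Dual.transpose (R := K) M - 1 = Module.Dual.transpose (R := K) (M - 1)
    rw [map_sub]
    congr 1
  rw [h, LinearMap.finrank_range_dualMap_eq_finrank_range]

/-- `tr (Mᵗ) = tr M`. [cite: Katz1990ESDE, §1.8 Prop. 1.8.2] -/
theorem trace_dualMap (M : E →ₗ[K] E) :
    LinearMap.trace K (Module.Dual K E) M.dualMap = LinearMap.trace K E M :=
  LinearMap.trace_transpose' M

end Twist

/-! ### §2 Trace and rank of Carlson–Toledo's complex reflections -/

section ComplexReflection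

variable {W : Type*} [AddCommGroup W] [Module ℂ W]

/-- **Trace of a complex `λ`-reflection along a unit vector**: `tr s_δ = dim W + (λ − 1)` (`h(δ,δ) = ε`,
`ε² = 1`). [cite: CarlsonToledo1999, §7 Theorem udensitytheo] -/
theorem trace_complexReflection [FiniteDimensional ℂ W] (B : W →ₗ⋆[ℂ] W →ₗ[ℂ] ℂ) {ε : ℂ} (hε : ε * ε = 1)
    (l : ℂ) {δ : W} (hδ : B δ δ = ε) :
    LinearMap.trace ℂ W (complexReflection B ε l δ) = (finrank ℂ W : ℂ) + (l - 1) := by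
  rw [complexReflection, map_add, map_smul, LinearMap.trace_id, LinearMap.trace_smulRight, hδ, smul_eq_mul]
  linear_combination (l - 1) * hε

/-- **A complex `λ`-reflection with `λ ≠ 1` is a pseudo-reflection**: `rank(s_δ − id) = 1` (its image is the
line `ℂδ`; `δ ≠ 0` since `h(δ,δ) = ε ≠ 0`). [cite: CarlsonToledo1999, §7 Theorem udensitytheo] -/
theorem finrank_range_complexReflection_sub_id [FiniteDimensional ℂ W] (B : W →ₗ⋆[ℂ] W →ₗ[ℂ] ℂ) {ε : ℂ}
    (hε : ε * ε = 1) {l : ℂ} (hl : l ≠ 1) {δ : W} (hδ : B δ δ = ε) :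
    finrank ℂ (LinearMap.range (complexReflection B ε l δ - 1)) = 1 := by
  have hε0 : ε ≠ 0 := fun h => by rw [h, mul_zero] at hε; exact zero_ne_one hε
  have hδ0 : δ ≠ 0 := by
    rintro rfl
    simp only [map_zero] at hδ
    exact hε0 hδ.symm
  have hBδ : B δ ≠ 0 := fun h => hε0 (by rw [← hδ, h, LinearMap.zero_apply])
  have hc : ε * (l - 1) ≠ 0 := mul_ne_zero hε0 (sub_ne_zero.2 hl)
  have hsub : complexReflection B ε l δ - 1 = (ε * (l - 1)) • (B δ).smulRight δ := by
    rw [complexReflection, Module.End.one_eq_id, add_sub_cancel_left]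
  rw [hsub, LinearMap.range_smul _ _ hc, LinearMap.range_smulRight_apply hBδ, finrank_span_singleton hδ0]

/-- **Refutation of a twist between reflections with different multipliers** (the shape of Katz's
hypothesis (3) for the monodromy of the cyclic family): complex `λ`- and `λ'`-reflections of hermitian
spaces of the same dimension `≥ 3` (`λ, λ' ≠ 1`) that satisfy `A ∘ s = χ • (s' ∘ A)` for some isomorphism
`A` and scalar `χ` have `λ = λ'`. [cite: Katz1990ESDE, §1.8 Prop. 1.8.2] [cite: CarlsonToledo1999, §7 Theorem udensitytheo] -/
theorem multiplier_eq_of_twist_complexReflection {W' : Type*} [AddCommGroup W'] [Module ℂ W']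
    [FiniteDimensional ℂ W] [FiniteDimensional ℂ W'] (h3 : 3 ≤ finrank ℂ W)
    (B : W →ₗ⋆[ℂ] W →ₗ[ℂ] ℂ) (B' : W' →ₗ⋆[ℂ] W' →ₗ[ℂ] ℂ) {ε ε' : ℂ} (hε : ε * ε = 1) (hε' : ε' * ε' = 1)
    {l l' : ℂ} (hl : l ≠ 1) (hl' : l' ≠ 1) {δ : W} {δ' : W'} (hδ : B δ δ = ε) (hδ' : B' δ' δ' = ε')
    (A : W ≃ₗ[ℂ] W') {χ : ℂ}
    (hA : (A : W →ₗ[ℂ] W') ∘ₗ complexReflection B ε l δ = χ • (complexReflection B' ε' l' δ' ∘ₗ (A : W →ₗ[ℂ] W'))) :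
    l = l' := by
  obtain ⟨-, htr⟩ := trace_eq_of_twist_of_rank_sub_one h3
    (finrank_range_complexReflection_sub_id B hε hl hδ) (finrank_range_complexReflection_sub_id B' hε' hl' hδ').le A hA
  rw [trace_complexReflection B hε l hδ, trace_complexReflection B' hε' l' hδ', A.finrank_eq] at htr
  have := add_left_cancel htr
  exact sub_left_injective this

end ComplexReflection

end Literature.AlgebraicGeometry.HodgeTheory

end
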